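import Summits.NavierStokesRegularity.NavierStokesRegularity.Theorems.SelfMixingDichotomyMixingPayoffWindowRegularity
import Summits.NavierStokesRegularity.NavierStokesRegularity.Theorems.SelfMixingDichotomyMixingPayoffAdvectionDiffusionSchwartz
import Summits.NavierStokesRegularity.NavierStokesRegularity.Theorems.SelfMixingDichotomyMixingPayoffAdmissibleDriftHeatClass
import Summits.NavierStokesRegularity.NavierStokesRegularity.Theorems.SelfMixingDichotomyMixingPayoffAdmissibleMinPrinciple
import Summits.NavierStokesRegularity.NavierStokesRegularity.Theorems.SelfMixingDichotomyMixingPayoffDriftHeatBumpFloor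
import Summits.NavierStokesRegularity.NavierStokesRegularity.Theorems.SelfMixingDichotomyMixingPayoffTypeIFloorAssembly
import Literature.Analysis.FluidPDE.DissipatesAtScale
import HarnessLib

set_option linter.dupNamespace false

/-!
# Route SelfMixingDichotomy — crux `CoherentScaleExclusion` (S2, item stmt-NavierStokesRegularity-1423),
# line `birth`, helper T2: `L∞`-Type-I points are `δ`-coherent at all small scales

Support file (`--supports stmt-NavierStokesRegularity-1423`) for the registered stub
`stub_typeICoherence` of the line `Cruxes/CoherentScaleExclusion/Lines/birth.lean`.

Write `MIX(u, T, x₀, r, δ) = DissipatesAtScale u T x₀ r δ` (every MIX-admissible passive scalar on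
the window `[T − r², T − r²/2]` with datum supported in `B_r(x₀)` keeps at most the fraction `δ` of
its `L²` norm). The sibling crux `MixingPayoff` (stmt-NavierStokesRegularity-1422) has landed, in
this directory and fully proved, the two facts

* **W** — `stub_windowRegularity` + `stub_advectionDiffusionSchwartz`: for a standing solution
  (`0 < T`, classical on `[0,T)`, Leray–Hopf from `u 0`, rapidly decaying datum) and `0 < r`,
  `r² < T`, every `C_c^∞` datum launches a MIX-admissible scalar on `[T − r², T − r²/2]`
  (re-glued below as the private lemma `typeICoherence_scalarSlabWellposed`);
* **F** — `stub_typeIFloorAssembly stub_admissibleDriftHeatClass stub_admissibleMinPrinciple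
  stub_driftHeatBumpFloor`: for every `K > 0` there is `c₁(K) > 0` such that at a point `(T, x₀)`
  where a classical solution obeys the Type-I(K) velocity bound `√(T − t)‖u(t,x)‖ ≤ K` on a
  parabolic cylinder, for all small `r` every MIX-admissible scalar with bump datum (`0 ≤ θ₀ ≤ 1`,
  `θ₀ = 1` on `B̄(x₀, r/2)`, `supp θ₀ ⊆ B(x₀, r)`) satisfies `c₁² ∫ θ₀² < ∫ θ(T − r²/2)²`.

Together they give T2 (`stub_typeICoherence`): with `δ₁ := c₁(K)`, at an `L∞`-Type-I(K) point of a
standing solution `¬ MIX(u, T, x₀, r, δ)` for ALL `r` below some `r₂ > 0` and all `0 ≤ δ ≤ δ₁` —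
launch the `ContDiffBump` datum (`rIn = r/2`, `rOut = r`) by W; `MIX(r, δ)` gives
`∫ θ(T − r²/2)² ≤ δ² ∫ θ₀² ≤ c₁² ∫ θ₀²`, contradicting F.

No named fact is taken as a hypothesis: everything below is unconditional.
-/

noncomputable section

open Literature.Analysis.FluidPDE MeasureTheory Set Function Metric
open scoped ContDiff

namespace Summit.NavierStokesRegularity.NavierStokesRegularity.Theorems

/-- **W — well-posedness of the passive-scalar problem on a window** (glue of the landed
`stub_windowRegularity` and `stub_advectionDiffusionSchwartz`, as in the `MixingPayoff` skeleton).
For a standing solution (`0 < T`, classical on `[0,T)`, Leray–Hopf from `u 0`, rapidly decaying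
datum) and `0 < r`, `r² < T`, every `C_c^∞` datum `θ₀` launches a MIX-admissible scalar on
`[T − r², T − r²/2]` starting from it: the drift has all space–time derivatives bounded on the
closed window `[T − r², T − r²/2] ⊂ [0, T)` and the linear parabolic Cauchy problem is solvable in
the Schwartz-type class. -/
private theorem typeICoherence_scalarSlabWellposed :
    ∀ (T : ℝ) (u : ℝ → EuclideanSpace ℝ (Fin 3) → EuclideanSpace ℝ (Fin 3))
      (p : ℝ → EuclideanSpace ℝ (Fin 3) → ℝ), 0 < T →
    IsClassicalNSSolutionOn (Set.Ico 0 T) 1 0 u p → IsLerayHopfOn T 1 0 (u 0) u →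
    HasRapidSpatialDecay (u 0) →
    ∀ r : ℝ, 0 < r → r ^ 2 < T →
    ∀ θ₀ : EuclideanSpace ℝ (Fin 3) → ℝ, ContDiff ℝ ∞ θ₀ → HasCompactSupport θ₀ →
    ∃ θ : ℝ → EuclideanSpace ℝ (Fin 3) → ℝ,
      IsSmoothSpaceTimeOn (Set.Icc (T - r ^ 2) (T - r ^ 2 / 2)) θ ∧
      HasUniformRapidDecayOn (Set.Icc (T - r ^ 2) (T - r ^ 2 / 2)) θ ∧
      (∀ t ∈ Set.Icc (T - r ^ 2) (T - r ^ 2 / 2), ∀ x : EuclideanSpace ℝ (Fin 3),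
        timeDerivWithin (Set.Icc (T - r ^ 2) (T - r ^ 2 / 2)) θ t x
            + inner ℝ (u t x) (gradient (θ t) x)
          = Laplacian.laplacian (θ t) x) ∧
      θ (T - r ^ 2) = θ₀ := by
  intro T u p hT hcl hLH hdec r hr hrT θ₀ hθ₀ hθ₀c
  have ha : (0 : ℝ) ≤ T - r ^ 2 := by linarith
  have hab : T - r ^ 2 < T - r ^ 2 / 2 := by nlinarith
  have hb : T - r ^ 2 / 2 < T := by nlinarith
  obtain ⟨hsm, hbd⟩ :=
    stub_windowRegularity T u p hT hcl hLH hdec (T - r ^ 2) (T - r ^ 2 / 2) ha hab hb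
  exact stub_advectionDiffusionSchwartz (T - r ^ 2) (T - r ^ 2 / 2) hab u hsm hbd θ₀ hθ₀ hθ₀c

/-- **T2 — `L∞`-Type-I points are `δ`-coherent at all small scales** (registered stub
`stub_typeICoherence` of line `birth` of the crux `CoherentScaleExclusion`). For every `K > 0`
there is `δ₁ = δ₁(K) > 0` (namely the floor constant `c₁(K)` of F) such that for every standing
solution (`0 < T`, classical on `[0,T)`, Leray–Hopf from `u 0`, rapidly decaying datum) and every
`x₀` at which the Type-I(K) velocity bound `√(T − t)‖u(t,x)‖ ≤ K` holds on some parabolic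
cylinder `(T − r₁², T) × B(x₀, r₁)`, there is `r₂ > 0` with `¬ DissipatesAtScale u T x₀ r δ` for
all `r ∈ (0, r₂)` and all `0 ≤ δ ≤ δ₁`. Proof: F gives a floor scale `r₂'`; put
`r₂ := min r₂' √T` (so `r² < T` below it); at such `r`, W launches the MIX-admissible scalar `θ`
from the `ContDiffBump` datum centred at `x₀` (`rIn = r/2`, `rOut = r`); `MIX(r, δ)` says
`∫ θ(T − r²/2)² ≤ δ² ∫ θ(T − r²)² ≤ c₁² ∫ θ(T − r²)²` (`δ² ≤ c₁²`, the mass is nonnegative), while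
F says `c₁² ∫ θ(T − r²)² < ∫ θ(T − r²/2)²` — contradiction. -/
theorem stub_typeICoherence : ∀ K : ℝ, 0 < K → ∃ δ₁ : ℝ, 0 < δ₁ ∧ ∀ T : ℝ, 0 < T → ∀ (u : ℝ → EuclideanSpace ℝ (Fin 3) → EuclideanSpace ℝ (Fin 3)) (p : ℝ → EuclideanSpace ℝ (Fin 3) → ℝ), Literature.Analysis.FluidPDE.IsClassicalNSSolutionOn (Set.Ico 0 T) 1 0 u p → Literature.Analysis.FluidPDE.IsLerayHopfOn T 1 0 (u 0) u → Literature.Analysis.FluidPDE.HasRapidSpatialDecay (u 0) → ∀ x₀ : EuclideanSpace ℝ (Fin 3), (∃ r₁ : ℝ, 0 < r₁ ∧ ∀ t ∈ Set.Ioo (T - r₁ ^ 2) T, ∀ x ∈ Metric.ball x₀ r₁, Real.sqrt (T - t) * ‖u t x‖ ≤ K) → ∃ r₂ : ℝ, 0 < r₂ ∧ ∀ r ∈ Set.Ioo 0 r₂, ∀ δ : ℝ, 0 ≤ δ → δ ≤ δ₁ → ¬ Literature.Analysis.FluidPDE.DissipatesAtScale u T x₀ r δ := by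
  intro K hK
  -- F: the floor constant `c₁(K)`; we take `δ₁ := c₁`.
  obtain ⟨c₁, hc₁, hF⟩ :=
    stub_typeIFloorAssembly stub_admissibleDriftHeatClass stub_admissibleMinPrinciple
      stub_driftHeatBumpFloor K hK
  refine ⟨c₁, hc₁, ?_⟩
  intro T hT u p hcl hLH hdec x₀ hTI
  -- F at the Type-I(K) point: the floor scale `r₂'`.
  obtain ⟨r₂', hr₂', hfl⟩ := hF T u p hT hcl x₀ hTI
  refine ⟨min r₂' (Real.sqrt T), lt_min hr₂' (Real.sqrt_pos.2 hT), ?_⟩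
  intro r hr δ hδ₀ hδ₁ hmix
  obtain ⟨hr₀, hrlt⟩ := hr
  have hrr₂ : r < r₂' := hrlt.trans_le (min_le_left _ _)
  have hrT : r ^ 2 < T := by
    have h : r ^ 2 < Real.sqrt T ^ 2 :=
      pow_lt_pow_left₀ (hrlt.trans_le (min_le_right _ _)) hr₀.le two_ne_zero
    rwa [Real.sq_sqrt hT.le] at h
  -- W: the admissible scalar launched by the bump datum centred at `x₀`.
  let φ : ContDiffBump x₀ := ⟨r / 2, r, by positivity, by linarith⟩
  obtain ⟨θ, hsm, hdecay, hpde, hθ₀⟩ :=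
    typeICoherence_scalarSlabWellposed T u p hT hcl hLH hdec r hr₀ hrT φ φ.contDiff
      φ.hasCompactSupport
  have hsupp : Function.support (θ (T - r ^ 2)) ⊆ Metric.ball x₀ r := by
    rw [hθ₀, φ.support_eq]
  -- `MIX(r, δ)` on `θ` versus the floor on `θ`.
  have hM : ∫ x, (θ (T - r ^ 2 / 2) x) ^ 2 ≤ δ ^ 2 * ∫ x, (θ (T - r ^ 2) x) ^ 2 :=
    hmix θ hsm hdecay hpde hsupp
  have hL : c₁ ^ 2 * ∫ x, (θ (T - r ^ 2) x) ^ 2 < ∫ x, (θ (T - r ^ 2 / 2) x) ^ 2 :=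
    hfl r ⟨hr₀, hrr₂⟩ θ hsm hdecay hpde
      (fun x => by rw [hθ₀]; exact φ.nonneg)
      (fun x => by rw [hθ₀]; exact φ.le_one)
      (fun x hx => by rw [hθ₀]; exact φ.one_of_mem_closedBall hx)
      hsupp
  have hX : 0 ≤ ∫ x, (θ (T - r ^ 2) x) ^ 2 := integral_nonneg fun _ => sq_nonneg _
  have hδc : δ ^ 2 ≤ c₁ ^ 2 := pow_le_pow_left₀ hδ₀ hδ₁ 2
  have hlt : c₁ ^ 2 * ∫ x, (θ (T - r ^ 2) x) ^ 2 < c₁ ^ 2 * ∫ x, (θ (T - r ^ 2) x) ^ 2 :=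
    hL.trans_le (hM.trans (mul_le_mul_of_nonneg_right hδc hX))
  exact lt_irrefl _ hlt

end Summit.NavierStokesRegularity.NavierStokesRegularity.Theorems

end
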